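import Literature.GroupTheory.CombinatorialGroupTheory.PuncturedSurfaceGroupUnmarkedLevelBases
import Mathlib.Algebra.BigOperators.Fin
import HarnessLib

/-!
# Abelian certificates separating the node loop and the cusps of an unmarked-component degeneration IN A LEVEL

Topic `Literature/GroupTheory/CombinatorialGroupTheory`; theorems only; sequel to
`PuncturedSurfaceGroupUnmarkedLevelBases.lean` (same setting and hypotheses: `Γ = Γ_{g,r'+1}`, `t = a_{g₀}`,
level `K = Ker(χ : Γ → ℤ/n)`, abc-iut-w5-d174's Schreier basis `bK` with `Y_{x,k} = t^k x t^{-k}`, `T = t^n`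
[cite: LyndonSchupp2001, Ch. I Prop. 3.7]; `w = ∏_{i≥g₀}[a_i,b_i]` the inverted node loop, `c_0, …, c_{r'}`
the cusps, all on the marked component).  For [CombGC] Prop. 1.2's edge-like separating coverings at these
data (abc-iut-f-166 gen 5, `ProSigmaLevelSeparating.lean`: the "cross" engine needs, for the letter `s` to be
KILLED and the conjugate `z = t^m x t^{-m}` to SURVIVE, a homomorphism `ψ : K → M` with `ψ(s) = 1 ≠ ψ(z)` —
`retract_apply_ne_one_of_hom`) this file supplies the certificates `ψ : K → ℤ`:

* `exists_levelHom_eval` — for weights `φB : ℤ/n → ℤ` on the letters `Y_{b_{g₀},k}` and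
  `φC : Fin r' → ℤ/n → ℤ` on the letters `Y_{c_{j+1},k}` (all other letters `↦ 0`) the character
  `ψ = bK.lift` has `ψ(t^k w t^{-k}) = φB(k+1) − φB(k)`, `ψ(t^k c_{j+1} t^{-k}) = φC j k`,
  `ψ(t^k c_0 t^{-k}) = −(φB(k+1) − φB(k) + ∑_j φC j k)` (the abelian readings of the previous file);
* nine certificates `exists_certificate_<kill>_<survivor>` (kill ∈ {`w`, `c_{k+1}`, `c_0`}, survivor ∈
  {`t^m w t^{-m}`, `t^m c_{j+1} t^{-m}`, `t^m c_0 t^{-m}`}; `n ≥ 3`; survivor ≠ killed letter; the corners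
  `{w, c_0}`, `m ≡ 0`, `r' = 0` — `c_0 ≡ w⁻¹` modulo commutators of `K` — are not abelian and excluded).
Elementary; nothing here concerns [IUTchIII].
-/

namespace Literature.GroupTheory.CombinatorialGroupTheory

namespace PuncturedSurfaceGroup

open Multiplicative

section Certificates

variable {g r' g₀ n : ℕ} (hg : g₀ < g) [Fact (1 < n)]
variable (b₀ : FreeGroupBasis ((Fin g × Bool) ⊕ Fin r') (PuncturedSurfaceGroup g (r' + 1)))
variable (ha : ∀ i, b₀ (Sum.inl (i, false)) = a i) (hb : ∀ i, b₀ (Sum.inl (i, true)) = b i)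
variable (hc : ∀ j : Fin r', b₀ (Sum.inr j) = c (Fin.succ j))
variable (χ : PuncturedSurfaceGroup g (r' + 1) →* Multiplicative (ZMod n))
variable (hχa : ∀ i : Fin g, χ (a i) = if (i : ℕ) = g₀ then ofAdd 1 else 1)
variable (hχb : ∀ i : Fin g, χ (b i) = 1) (hχc : ∀ j : Fin (r' + 1), χ (c j) = 1)
variable (bK : FreeGroupBasis (({x : (Fin g × Bool) ⊕ Fin r' // x ≠ Sum.inl (⟨g₀, hg⟩, false)} × ZMod n) ⊕
    Unit) χ.ker)
variable (hbK : ∀ (x : {x : (Fin g × Bool) ⊕ Fin r' // x ≠ Sum.inl (⟨g₀, hg⟩, false)}) (k : ZMod n),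
    ((bK (Sum.inl (x, k)) : χ.ker) : PuncturedSurfaceGroup g (r' + 1)) =
      b₀ (Sum.inl (⟨g₀, hg⟩, false)) ^ k.val * b₀ x.1 * (b₀ (Sum.inl (⟨g₀, hg⟩, false)) ^ k.val)⁻¹)
variable (hbKT : ((bK (Sum.inr ()) : χ.ker) : PuncturedSurfaceGroup g (r' + 1)) =
    b₀ (Sum.inl (⟨g₀, hg⟩, false)) ^ n)

omit [Fact (1 < n)] in
include ha hb hc hχa hχb hχc hbK hbKT in
/-- **The weighted level character and its readings.**  For weights `φB` on the letters `Y_{b_{g₀},k}` and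
`φC j` on the letters `Y_{c_{j+1},k}` (zero elsewhere): `ψ(t^k w t^{-k}) = φB(k+1) − φB(k)`,
`ψ(t^k c_{j+1} t^{-k}) = φC j k`, `ψ(t^k c_0 t^{-k}) = −(φB(k+1) − φB(k) + ∑_j φC j k)`.
[cite: LyndonSchupp2001, Ch. I Prop. 3.7] -/
theorem exists_levelHom_eval (φB : ZMod n → ℤ) (φC : Fin r' → ZMod n → ℤ) :
    ∃ ψ : χ.ker →* Multiplicative ℤ,
      (∀ (k : ℕ) (h : a ⟨g₀, hg⟩ ^ k * ((List.finRange g).map fun i : Fin g => if g₀ ≤ (i : ℕ) then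
          a (r := r' + 1) i * b i * (a i)⁻¹ * (b i)⁻¹ else 1).prod * (a ⟨g₀, hg⟩ ^ k)⁻¹ ∈ χ.ker),
        ψ ⟨_, h⟩ = ofAdd (φB ((k + 1 : ℕ) : ZMod n) - φB (k : ZMod n))) ∧
      (∀ (j : Fin r') (k : ℕ) (h : a ⟨g₀, hg⟩ ^ k * c (Fin.succ j) * (a ⟨g₀, hg⟩ ^ k)⁻¹ ∈ χ.ker),
        ψ ⟨_, h⟩ = ofAdd (φC j (k : ZMod n))) ∧
      (∀ (k : ℕ) (h : a ⟨g₀, hg⟩ ^ k * c 0 * (a ⟨g₀, hg⟩ ^ k)⁻¹ ∈ χ.ker),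
        ψ ⟨_, h⟩ = ofAdd (-(φB ((k + 1 : ℕ) : ZMod n) - φB (k : ZMod n) + ∑ j : Fin r', φC j (k : ZMod n)))) := by
  classical
  let F : (({x : (Fin g × Bool) ⊕ Fin r' // x ≠ Sum.inl (⟨g₀, hg⟩, false)} × ZMod n) ⊕ Unit) →
      Multiplicative ℤ :=
    Sum.elim (fun p => Sum.elim (fun q : Fin g × Bool => if q = (⟨g₀, hg⟩, true) then ofAdd (φB p.2) else 1)
      (fun j : Fin r' => ofAdd (φC j p.2)) p.1.1) fun _ => 1
  let ψ : χ.ker →* Multiplicative ℤ := bK.lift F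
  have hψ : ∀ i, ψ (bK i) = F i := fun i => by
    change FreeGroup.lift F (bK.repr (bK i)) = F i
    rw [FreeGroupBasis.repr_apply_coe, FreeGroup.lift_apply_of]
  have hB : ∀ k : ZMod n, ψ (bK (Sum.inl (⟨Sum.inl (⟨g₀, hg⟩, true), by simp⟩, k))) = ofAdd (φB k) :=
    fun k => by rw [hψ]; simp [F]
  have hC : ∀ (j : Fin r') (k : ZMod n), ψ (bK (Sum.inl (⟨Sum.inr j, by simp⟩, k))) = ofAdd (φC j k) :=
    fun j k => by rw [hψ]; simp [F]
  refine ⟨ψ, fun k h => ?_, fun j k h => ?_, fun k h => ?_⟩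
  · rw [hom_conj_secondHandleProd_eq hg b₀ ha hb χ hχa hχb bK hbK hbKT ψ k h, hB, hB, ← div_eq_mul_inv,
      ← ofAdd_sub]
  · have h' : a ⟨g₀, hg⟩ ^ k * b₀ (Sum.inr j) * (a ⟨g₀, hg⟩ ^ k)⁻¹ ∈ χ.ker := by rw [hc]; exact h
    have e : (⟨_, h⟩ : χ.ker) = ⟨_, h'⟩ := Subtype.ext (by simp [hc])
    rw [e, hom_conj_letter_eq hg b₀ ha χ bK hbK hbKT ψ _ (by simp) k h', hC]
  · rw [hom_conj_cuspZero_eq hg b₀ ha hb hc χ hχa hχb hχc bK hbK hbKT ψ k h, hB, hB]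
    have hl : ((List.finRange r').map fun j : Fin r' =>
        ψ (bK (Sum.inl (⟨Sum.inr j, by simp⟩, (k : ZMod n))))).prod = ofAdd (∑ j : Fin r', φC j (k : ZMod n)) := by
      rw [Fin.sum_univ_def, ofAdd_list_prod, List.map_map]
      exact congrArg List.prod (List.map_congr_left fun j _ => by rw [Function.comp_apply, hC])
    rw [hl, ← div_eq_mul_inv, ← ofAdd_sub, ← ofAdd_add, ← ofAdd_neg]

omit [Fact (1 < n)] in
/-- For `n ≥ 3`: `(m+1) ≠ m`, and `2 ≠ 0`, in `ℤ/n`. [cite: LyndonSchupp2001, Ch. I Prop. 3.7] -/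
theorem zmod_succ_ne (hn : 3 ≤ n) (m : ℕ) : ((m + 1 : ℕ) : ZMod n) ≠ (m : ZMod n) ∧ (2 : ZMod n) ≠ 0 := by
  constructor
  · intro h
    rw [Nat.cast_succ, add_eq_left] at h
    haveI : Fact (1 < n) := ⟨by omega⟩
    exact one_ne_zero h
  · intro h
    have h2 : ((2 : ℕ) : ZMod n) = 0 := by exact_mod_cast h
    rw [ZMod.natCast_eq_zero_iff] at h2
    exact absurd (Nat.le_of_dvd (by norm_num) h2) (by omega)

include ha hb hc hχa hχb hχc hbK hbKT in
/-- **Kill `w`, keep `t^m w t^{-m}`** (`m ≢ 0 mod n`, `n ≥ 3`): weights `δ_{m+1}` on the `b_{g₀}`-letters if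
`m+1 ≢ 0`, else `δ_0 + δ_1`. [cite: LyndonSchupp2001, Ch. I Prop. 3.7] -/
theorem exists_certificate_node_node (hn : 3 ≤ n) (m : ℕ) (hm0 : (m : ZMod n) ≠ 0)
    (hw : ((List.finRange g).map fun i : Fin g => if g₀ ≤ (i : ℕ) then
        a (r := r' + 1) i * b i * (a i)⁻¹ * (b i)⁻¹ else 1).prod ∈ χ.ker)
    (hz : a ⟨g₀, hg⟩ ^ m * ((List.finRange g).map fun i : Fin g => if g₀ ≤ (i : ℕ) then
        a (r := r' + 1) i * b i * (a i)⁻¹ * (b i)⁻¹ else 1).prod * (a ⟨g₀, hg⟩ ^ m)⁻¹ ∈ χ.ker) :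
    ∃ ψ : χ.ker →* Multiplicative ℤ, ψ ⟨_, hw⟩ = 1 ∧ ψ ⟨_, hz⟩ ≠ 1 := by
  classical
  obtain ⟨h1, h2⟩ := zmod_succ_ne hn m
  by_cases hm1 : ((m + 1 : ℕ) : ZMod n) = 0
  · obtain ⟨ψ, hW, -, -⟩ := exists_levelHom_eval hg b₀ ha hb hc χ hχa hχb hχc bK hbK hbKT
      (fun k => if k = 0 ∨ k = 1 then 1 else 0) (fun _ _ => 0)
    have hw0 : a ⟨g₀, hg⟩ ^ 0 * ((List.finRange g).map fun i : Fin g => if g₀ ≤ (i : ℕ) then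
        a (r := r' + 1) i * b i * (a i)⁻¹ * (b i)⁻¹ else 1).prod * (a ⟨g₀, hg⟩ ^ 0)⁻¹ ∈ χ.ker := by
      simpa using hw
    refine ⟨ψ, ?_, ?_⟩
    · rw [show (⟨_, hw⟩ : χ.ker) = ⟨_, hw0⟩ from Subtype.ext (by simp), hW 0]
      simp
    · rw [hW m, hm1]
      have hm' : ¬ ((m : ZMod n) = 0 ∨ (m : ZMod n) = 1) := by
        rintro (h | h)
        · exact hm0 h
        · apply h2
          have : ((m + 1 : ℕ) : ZMod n) = 2 := by rw [Nat.cast_succ, h]; norm_num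
          rw [← this, hm1]
      simp [hm']
  · obtain ⟨ψ, hW, -, -⟩ := exists_levelHom_eval hg b₀ ha hb hc χ hχa hχb hχc bK hbK hbKT
      (fun k => if k = ((m + 1 : ℕ) : ZMod n) then 1 else 0) (fun _ _ => 0)
    have hw0 : a ⟨g₀, hg⟩ ^ 0 * ((List.finRange g).map fun i : Fin g => if g₀ ≤ (i : ℕ) then
        a (r := r' + 1) i * b i * (a i)⁻¹ * (b i)⁻¹ else 1).prod * (a ⟨g₀, hg⟩ ^ 0)⁻¹ ∈ χ.ker := by
      simpa using hw
    refine ⟨ψ, ?_, ?_⟩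
    · rw [show (⟨_, hw⟩ : χ.ker) = ⟨_, hw0⟩ from Subtype.ext (by simp), hW 0]
      have h01 : ¬ (((0 + 1 : ℕ) : ZMod n) = ((m + 1 : ℕ) : ZMod n)) := by
        intro h; apply hm0
        have h' : ((m : ℕ) : ZMod n) + 1 = 0 + 1 := by push_cast at h; rw [zero_add]; exact h.symm
        exact add_right_cancel h'
      have h00 : ¬ (((0 : ℕ) : ZMod n) = ((m + 1 : ℕ) : ZMod n)) := fun h => hm1 (by
          rw [← h, Nat.cast_zero])
      simp only [h01, h00, if_false, sub_self, ofAdd_zero]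
    · rw [hW m]
      simp

omit [Fact (1 < n)] in
include ha hb hc hχa hχb hχc hbK hbKT in
/-- **Kill `w`, keep `t^m c_{j+1} t^{-m}`**: weight `δ` on the letter `Y_{c_{j+1},m}`.
[cite: LyndonSchupp2001, Ch. I Prop. 3.7] -/
theorem exists_certificate_node_cuspSucc (j : Fin r') (m : ℕ)
    (hw : ((List.finRange g).map fun i : Fin g => if g₀ ≤ (i : ℕ) then
        a (r := r' + 1) i * b i * (a i)⁻¹ * (b i)⁻¹ else 1).prod ∈ χ.ker)
    (hz : a ⟨g₀, hg⟩ ^ m * c (Fin.succ j) * (a ⟨g₀, hg⟩ ^ m)⁻¹ ∈ χ.ker) :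
    ∃ ψ : χ.ker →* Multiplicative ℤ, ψ ⟨_, hw⟩ = 1 ∧ ψ ⟨_, hz⟩ ≠ 1 := by
  classical
  obtain ⟨ψ, hW, hC, -⟩ := exists_levelHom_eval hg b₀ ha hb hc χ hχa hχb hχc bK hbK hbKT (fun _ => 0)
    (fun j' k => if j' = j ∧ k = (m : ZMod n) then 1 else 0)
  have hw0 : a ⟨g₀, hg⟩ ^ 0 * ((List.finRange g).map fun i : Fin g => if g₀ ≤ (i : ℕ) then
      a (r := r' + 1) i * b i * (a i)⁻¹ * (b i)⁻¹ else 1).prod * (a ⟨g₀, hg⟩ ^ 0)⁻¹ ∈ χ.ker := by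
    simpa using hw
  refine ⟨ψ, ?_, ?_⟩
  · rw [show (⟨_, hw⟩ : χ.ker) = ⟨_, hw0⟩ from Subtype.ext (by simp), hW 0]; simp
  · rw [hC j m]; simp

include ha hb hc hχa hχb hχc hbK hbKT in
/-- **Kill `w`, keep `t^m c_0 t^{-m}`** outside the corner (`r' ≥ 1`, weight `δ` on `Y_{c_1,m}`; or
`m ≢ 0`, the `b_{g₀}`-weights of the node case). [cite: LyndonSchupp2001, Ch. I Prop. 3.7] -/
theorem exists_certificate_node_cuspZero (hn : 3 ≤ n) (m : ℕ) (hcorner : 1 ≤ r' ∨ (m : ZMod n) ≠ 0)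
    (hw : ((List.finRange g).map fun i : Fin g => if g₀ ≤ (i : ℕ) then
        a (r := r' + 1) i * b i * (a i)⁻¹ * (b i)⁻¹ else 1).prod ∈ χ.ker)
    (hz : a ⟨g₀, hg⟩ ^ m * c 0 * (a ⟨g₀, hg⟩ ^ m)⁻¹ ∈ χ.ker) :
    ∃ ψ : χ.ker →* Multiplicative ℤ, ψ ⟨_, hw⟩ = 1 ∧ ψ ⟨_, hz⟩ ≠ 1 := by
  classical
  have hw0 : a ⟨g₀, hg⟩ ^ 0 * ((List.finRange g).map fun i : Fin g => if g₀ ≤ (i : ℕ) then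
      a (r := r' + 1) i * b i * (a i)⁻¹ * (b i)⁻¹ else 1).prod * (a ⟨g₀, hg⟩ ^ 0)⁻¹ ∈ χ.ker := by
    simpa using hw
  have ew : (⟨_, hw⟩ : χ.ker) = ⟨_, hw0⟩ := Subtype.ext (by simp)
  rcases Nat.eq_zero_or_pos r' with hr | hr
  · -- `r' = 0`: no other cusp; use the node weights (needs `m ≢ 0`)
    have hm0 : (m : ZMod n) ≠ 0 := hcorner.resolve_left (by omega)
    have hwz : a ⟨g₀, hg⟩ ^ m * ((List.finRange g).map fun i : Fin g => if g₀ ≤ (i : ℕ) then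
        a (r := r' + 1) i * b i * (a i)⁻¹ * (b i)⁻¹ else 1).prod * (a ⟨g₀, hg⟩ ^ m)⁻¹ ∈ χ.ker :=
      conj_pow_mem_levelKer χ hw _ m
    obtain ⟨h1, h2⟩ := zmod_succ_ne hn m
    subst hr
    by_cases hm1 : ((m + 1 : ℕ) : ZMod n) = 0
    · obtain ⟨ψ, hW, -, hZ⟩ := exists_levelHom_eval hg b₀ ha hb hc χ hχa hχb hχc bK hbK hbKT
        (fun k => if k = 0 ∨ k = 1 then 1 else 0) (fun _ _ => 0)
      refine ⟨ψ, ?_, ?_⟩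
      · rw [ew, hW 0]; simp
      · rw [hZ m, hm1]
        have hm' : ¬ ((m : ZMod n) = 0 ∨ (m : ZMod n) = 1) := by
          rintro (h | h)
          · exact hm0 h
          · apply h2
            have : ((m + 1 : ℕ) : ZMod n) = 2 := by rw [Nat.cast_succ, h]; norm_num
            rw [← this, hm1]
        simp [hm']
    · obtain ⟨ψ, hW, -, hZ⟩ := exists_levelHom_eval hg b₀ ha hb hc χ hχa hχb hχc bK hbK hbKT
        (fun k => if k = ((m + 1 : ℕ) : ZMod n) then 1 else 0) (fun _ _ => 0)
      refine ⟨ψ, ?_, ?_⟩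
      · rw [ew, hW 0]
        have h01 : ¬ (((0 + 1 : ℕ) : ZMod n) = ((m + 1 : ℕ) : ZMod n)) := by
          intro h; apply hm0
          have h' : ((m : ℕ) : ZMod n) + 1 = 0 + 1 := by push_cast at h; rw [zero_add]; exact h.symm
          exact add_right_cancel h'
        have h00 : ¬ (((0 : ℕ) : ZMod n) = ((m + 1 : ℕ) : ZMod n)) := fun h => hm1 (by
          rw [← h, Nat.cast_zero])
        simp only [h01, h00, if_false, sub_self, ofAdd_zero]
      · rw [hZ m]
        simp
  · -- `r' ≥ 1`: weight on `Y_{c_1, m}`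
    obtain ⟨ψ, hW, -, hZ⟩ := exists_levelHom_eval hg b₀ ha hb hc χ hχa hχb hχc bK hbK hbKT (fun _ => 0)
      (fun j' k => if j' = ⟨0, hr⟩ ∧ k = (m : ZMod n) then 1 else 0)
    refine ⟨ψ, ?_, ?_⟩
    · rw [ew, hW 0]; simp
    · rw [hZ m]
      simp [Finset.sum_ite_eq']

/-! ### Certificates: KILL a cusp `c_{k+1}` -/

include ha hb hc hχa hχb hχc hbK hbKT in
/-- **Kill `c_{k+1}`, keep `t^m w t^{-m}`** (any `m`): weight `δ_{m+1}` on the `b_{g₀}`-letters.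
[cite: LyndonSchupp2001, Ch. I Prop. 3.7] -/
theorem exists_certificate_cuspSucc_node (hn : 3 ≤ n) (k₀ : Fin r') (m : ℕ)
    (hk : c (g := g) (Fin.succ k₀) ∈ χ.ker)
    (hz : a ⟨g₀, hg⟩ ^ m * ((List.finRange g).map fun i : Fin g => if g₀ ≤ (i : ℕ) then
        a (r := r' + 1) i * b i * (a i)⁻¹ * (b i)⁻¹ else 1).prod * (a ⟨g₀, hg⟩ ^ m)⁻¹ ∈ χ.ker) :
    ∃ ψ : χ.ker →* Multiplicative ℤ, ψ ⟨_, hk⟩ = 1 ∧ ψ ⟨_, hz⟩ ≠ 1 := by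
  classical
  obtain ⟨h1, -⟩ := zmod_succ_ne hn m
  obtain ⟨ψ, hW, hC, -⟩ := exists_levelHom_eval hg b₀ ha hb hc χ hχa hχb hχc bK hbK hbKT
    (fun k => if k = ((m + 1 : ℕ) : ZMod n) then 1 else 0) (fun _ _ => 0)
  have hk0 : a ⟨g₀, hg⟩ ^ 0 * c (g := g) (Fin.succ k₀) * (a ⟨g₀, hg⟩ ^ 0)⁻¹ ∈ χ.ker := by simpa using hk
  refine ⟨ψ, ?_, ?_⟩
  · rw [show (⟨_, hk⟩ : χ.ker) = ⟨_, hk0⟩ from Subtype.ext (by simp), hC k₀ 0]; simp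
  · rw [hW m]
    simp

omit [Fact (1 < n)] in
include ha hb hc hχa hχb hχc hbK hbKT in
/-- **Kill `c_{k+1}`, keep `t^m c_{j+1} t^{-m}`** (`(j, m) ≠ (k, 0)`): weight `δ` on `Y_{c_{j+1},m}`.
[cite: LyndonSchupp2001, Ch. I Prop. 3.7] -/
theorem exists_certificate_cuspSucc_cuspSucc (k₀ j : Fin r') (m : ℕ) (hne : j ≠ k₀ ∨ (m : ZMod n) ≠ 0)
    (hk : c (g := g) (Fin.succ k₀) ∈ χ.ker)
    (hz : a ⟨g₀, hg⟩ ^ m * c (Fin.succ j) * (a ⟨g₀, hg⟩ ^ m)⁻¹ ∈ χ.ker) :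
    ∃ ψ : χ.ker →* Multiplicative ℤ, ψ ⟨_, hk⟩ = 1 ∧ ψ ⟨_, hz⟩ ≠ 1 := by
  classical
  obtain ⟨ψ, -, hC, -⟩ := exists_levelHom_eval hg b₀ ha hb hc χ hχa hχb hχc bK hbK hbKT (fun _ => 0)
    (fun j' k => if j' = j ∧ k = (m : ZMod n) then 1 else 0)
  have hk0 : a ⟨g₀, hg⟩ ^ 0 * c (g := g) (Fin.succ k₀) * (a ⟨g₀, hg⟩ ^ 0)⁻¹ ∈ χ.ker := by simpa using hk
  refine ⟨ψ, ?_, ?_⟩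
  · rw [show (⟨_, hk⟩ : χ.ker) = ⟨_, hk0⟩ from Subtype.ext (by simp), hC k₀ 0]
    have : ¬ (k₀ = j ∧ ((0 : ℕ) : ZMod n) = (m : ZMod n)) := by
      rintro ⟨rfl, h⟩
      rcases hne with h' | h'
      · exact h' rfl
      · exact h' (by rw [← h]; simp)
    simp only [this, if_false, ofAdd_zero]
  · rw [hC j m]; simp

include ha hb hc hχa hχb hχc hbK hbKT in
/-- **Kill `c_{k+1}`, keep `t^m c_0 t^{-m}`** (any `m`): weight `δ_{m+1}` on the `b_{g₀}`-letters.
[cite: LyndonSchupp2001, Ch. I Prop. 3.7] -/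
theorem exists_certificate_cuspSucc_cuspZero (hn : 3 ≤ n) (k₀ : Fin r') (m : ℕ)
    (hk : c (g := g) (Fin.succ k₀) ∈ χ.ker)
    (hz : a ⟨g₀, hg⟩ ^ m * c 0 * (a ⟨g₀, hg⟩ ^ m)⁻¹ ∈ χ.ker) :
    ∃ ψ : χ.ker →* Multiplicative ℤ, ψ ⟨_, hk⟩ = 1 ∧ ψ ⟨_, hz⟩ ≠ 1 := by
  classical
  obtain ⟨h1, -⟩ := zmod_succ_ne hn m
  obtain ⟨ψ, -, hC, hZ⟩ := exists_levelHom_eval hg b₀ ha hb hc χ hχa hχb hχc bK hbK hbKT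
    (fun k => if k = ((m + 1 : ℕ) : ZMod n) then 1 else 0) (fun _ _ => 0)
  have hk0 : a ⟨g₀, hg⟩ ^ 0 * c (g := g) (Fin.succ k₀) * (a ⟨g₀, hg⟩ ^ 0)⁻¹ ∈ χ.ker := by simpa using hk
  refine ⟨ψ, ?_, ?_⟩
  · rw [show (⟨_, hk⟩ : χ.ker) = ⟨_, hk0⟩ from Subtype.ext (by simp), hC k₀ 0]; simp
  · rw [hZ m]
    simp

/-! ### Certificates: KILL the cusp `c_0` -/

include ha hb hc hχa hχb hχc hbK hbKT in
/-- **Kill `c_0`, keep `t^m w t^{-m}`** outside the corner: for `m ≢ 0` the node weights, for `m ≡ 0` and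
`r' ≥ 1` the weights `δ_{Y_{b,1}} − δ_{Y_{c_1,0}}`. [cite: LyndonSchupp2001, Ch. I Prop. 3.7] -/
theorem exists_certificate_cuspZero_node (hn : 3 ≤ n) (m : ℕ) (hcorner : 1 ≤ r' ∨ (m : ZMod n) ≠ 0)
    (hk : c (g := g) 0 ∈ χ.ker)
    (hz : a ⟨g₀, hg⟩ ^ m * ((List.finRange g).map fun i : Fin g => if g₀ ≤ (i : ℕ) then
        a (r := r' + 1) i * b i * (a i)⁻¹ * (b i)⁻¹ else 1).prod * (a ⟨g₀, hg⟩ ^ m)⁻¹ ∈ χ.ker) :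
    ∃ ψ : χ.ker →* Multiplicative ℤ, ψ ⟨_, hk⟩ = 1 ∧ ψ ⟨_, hz⟩ ≠ 1 := by
  classical
  have hk0 : a ⟨g₀, hg⟩ ^ 0 * c (g := g) 0 * (a ⟨g₀, hg⟩ ^ 0)⁻¹ ∈ χ.ker := by simpa using hk
  have ek : (⟨_, hk⟩ : χ.ker) = ⟨_, hk0⟩ := Subtype.ext (by simp)
  obtain ⟨h1, h2⟩ := zmod_succ_ne hn m
  by_cases hm0 : (m : ZMod n) = 0
  · have hr : 1 ≤ r' := hcorner.resolve_right (fun h => h hm0)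
    obtain ⟨ψ, hW, -, hZ⟩ := exists_levelHom_eval hg b₀ ha hb hc χ hχa hχb hχc bK hbK hbKT
      (fun k => if k = 1 then 1 else 0) (fun j' k => if j' = ⟨0, hr⟩ ∧ k = 0 then -1 else 0)
    refine ⟨ψ, ?_, ?_⟩
    · rw [ek, hZ 0]; simp [Finset.sum_ite_eq']
    · rw [hW m, hm0]
      have e1 : ((m + 1 : ℕ) : ZMod n) = 1 := by push_cast; rw [hm0, zero_add]
      rw [e1]; simp
  · by_cases hm1 : ((m + 1 : ℕ) : ZMod n) = 0
    · obtain ⟨ψ, hW, -, hZ⟩ := exists_levelHom_eval hg b₀ ha hb hc χ hχa hχb hχc bK hbK hbKT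
        (fun k => if k = 0 ∨ k = 1 then 1 else 0) (fun _ _ => 0)
      refine ⟨ψ, ?_, ?_⟩
      · rw [ek, hZ 0]; simp
      · rw [hW m, hm1]
        have hm' : ¬ ((m : ZMod n) = 0 ∨ (m : ZMod n) = 1) := by
          rintro (h | h)
          · exact hm0 h
          · apply h2
            have : ((m + 1 : ℕ) : ZMod n) = 2 := by rw [Nat.cast_succ, h]; norm_num
            rw [← this, hm1]
        simp [hm']
    · obtain ⟨ψ, hW, -, hZ⟩ := exists_levelHom_eval hg b₀ ha hb hc χ hχa hχb hχc bK hbK hbKT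
        (fun k => if k = ((m + 1 : ℕ) : ZMod n) then 1 else 0) (fun _ _ => 0)
      refine ⟨ψ, ?_, ?_⟩
      · rw [ek, hZ 0]
        have h01 : ¬ (((0 + 1 : ℕ) : ZMod n) = ((m + 1 : ℕ) : ZMod n)) := by
          intro h; apply hm0
          have h' : ((m : ℕ) : ZMod n) + 1 = 0 + 1 := by push_cast at h; rw [zero_add]; exact h.symm
          exact add_right_cancel h'
        have h00 : ¬ (((0 : ℕ) : ZMod n) = ((m + 1 : ℕ) : ZMod n)) := fun h => hm1 (by
          rw [← h, Nat.cast_zero])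
        simp only [h01, h00, if_false, sub_self, Finset.sum_const_zero, add_zero, neg_zero, ofAdd_zero]
      · rw [hW m]
        simp

include ha hb hc hχa hχb hχc hbK hbKT in
/-- **Kill `c_0`, keep `t^m c_{j+1} t^{-m}`**: weight `δ` on `Y_{c_{j+1},m}` for `m ≢ 0`; for `m ≡ 0` the
weights `δ_{Y_{c_{j+1},0}} + δ_{Y_{b,0}}`. [cite: LyndonSchupp2001, Ch. I Prop. 3.7] -/
theorem exists_certificate_cuspZero_cuspSucc (j : Fin r') (m : ℕ) (hk : c (g := g) 0 ∈ χ.ker)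
    (hz : a ⟨g₀, hg⟩ ^ m * c (Fin.succ j) * (a ⟨g₀, hg⟩ ^ m)⁻¹ ∈ χ.ker) :
    ∃ ψ : χ.ker →* Multiplicative ℤ, ψ ⟨_, hk⟩ = 1 ∧ ψ ⟨_, hz⟩ ≠ 1 := by
  classical
  have hk0 : a ⟨g₀, hg⟩ ^ 0 * c (g := g) 0 * (a ⟨g₀, hg⟩ ^ 0)⁻¹ ∈ χ.ker := by simpa using hk
  have ek : (⟨_, hk⟩ : χ.ker) = ⟨_, hk0⟩ := Subtype.ext (by simp)
  by_cases hm0 : (m : ZMod n) = 0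
  · obtain ⟨ψ, -, hC, hZ⟩ := exists_levelHom_eval hg b₀ ha hb hc χ hχa hχb hχc bK hbK hbKT
      (fun k => if k = 0 then 1 else 0) (fun j' k => if j' = j ∧ k = 0 then 1 else 0)
    refine ⟨ψ, ?_, ?_⟩
    · rw [ek, hZ 0]
      haveI : Fact (1 < n) := inferInstance
      simp [Finset.sum_ite_eq']
    · rw [hC j m, hm0]; simp
  · obtain ⟨ψ, -, hC, hZ⟩ := exists_levelHom_eval hg b₀ ha hb hc χ hχa hχb hχc bK hbK hbKT (fun _ => 0)
      (fun j' k => if j' = j ∧ k = (m : ZMod n) then 1 else 0)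
    refine ⟨ψ, ?_, ?_⟩
    · rw [ek, hZ 0]
      have h0m : ¬ ((0 : ZMod n) = (m : ZMod n)) := fun h => hm0 h.symm
      simp [h0m]
    · rw [hC j m]; simp

include ha hb hc hχa hχb hχc hbK hbKT in
/-- **Kill `c_0`, keep `t^m c_0 t^{-m}`** (`m ≢ 0`): the node weights (`c_0 ≡ w⁻¹` modulo the cusps
`c_{j+1}` and commutators). [cite: LyndonSchupp2001, Ch. I Prop. 3.7] -/
theorem exists_certificate_cuspZero_cuspZero (hn : 3 ≤ n) (m : ℕ) (hm0 : (m : ZMod n) ≠ 0)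
    (hk : c (g := g) 0 ∈ χ.ker) (hz : a ⟨g₀, hg⟩ ^ m * c 0 * (a ⟨g₀, hg⟩ ^ m)⁻¹ ∈ χ.ker) :
    ∃ ψ : χ.ker →* Multiplicative ℤ, ψ ⟨_, hk⟩ = 1 ∧ ψ ⟨_, hz⟩ ≠ 1 := by
  classical
  have hk0 : a ⟨g₀, hg⟩ ^ 0 * c (g := g) 0 * (a ⟨g₀, hg⟩ ^ 0)⁻¹ ∈ χ.ker := by simpa using hk
  have ek : (⟨_, hk⟩ : χ.ker) = ⟨_, hk0⟩ := Subtype.ext (by simp)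
  obtain ⟨h1, h2⟩ := zmod_succ_ne hn m
  by_cases hm1 : ((m + 1 : ℕ) : ZMod n) = 0
  · obtain ⟨ψ, -, -, hZ⟩ := exists_levelHom_eval hg b₀ ha hb hc χ hχa hχb hχc bK hbK hbKT
      (fun k => if k = 0 ∨ k = 1 then 1 else 0) (fun _ _ => 0)
    refine ⟨ψ, ?_, ?_⟩
    · rw [ek, hZ 0]; simp
    · rw [hZ m, hm1]
      have hm' : ¬ ((m : ZMod n) = 0 ∨ (m : ZMod n) = 1) := by
        rintro (h | h)
        · exact hm0 h
        · apply h2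
          have : ((m + 1 : ℕ) : ZMod n) = 2 := by rw [Nat.cast_succ, h]; norm_num
          rw [← this, hm1]
      simp [hm']
  · obtain ⟨ψ, -, -, hZ⟩ := exists_levelHom_eval hg b₀ ha hb hc χ hχa hχb hχc bK hbK hbKT
      (fun k => if k = ((m + 1 : ℕ) : ZMod n) then 1 else 0) (fun _ _ => 0)
    refine ⟨ψ, ?_, ?_⟩
    · rw [ek, hZ 0]
      have h01 : ¬ (((0 + 1 : ℕ) : ZMod n) = ((m + 1 : ℕ) : ZMod n)) := by
        intro h; apply hm0
        have h' : ((m : ℕ) : ZMod n) + 1 = 0 + 1 := by push_cast at h; rw [zero_add]; exact h.symm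
        exact add_right_cancel h'
      have h00 : ¬ (((0 : ℕ) : ZMod n) = ((m + 1 : ℕ) : ZMod n)) := fun h => hm1 (by
          rw [← h, Nat.cast_zero])
      simp only [h01, h00, if_false, sub_self, Finset.sum_const_zero, add_zero, neg_zero, ofAdd_zero]
    · rw [hZ m]
      simp

end Certificates

end PuncturedSurfaceGroup

end Literature.GroupTheory.CombinatorialGroupTheory
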